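import Summits.CriticalPhenomena.SAWScalingLimit.Theorems.SAWTotalPositivityCriticalBubbleBoundJoinMacroDoor

/-!
# Block decay from macroscopic join rarity (stubs `joinMass_blockDecay_of_joinMacroRarity`,
`join_blockMass_term_le_of_joinMacroRarity` of line `docking-census-joining`, crux
stmt-CriticalPhenomena-7117 `Summit.CriticalPhenomena.SAWScalingLimit.Theses.SAWTotalPositivity.CriticalBubbleBound`;
lead prover c7)

The QUANTITATIVE meaning of the macroscopic-rarity obligation `JoinMacroRarity π` below the door's
threshold: "block-averaged `θ ≥ 3/2 + π`".  The landed ledger bootstrap `Docking.stub_ledgerBootstrap`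
(the exponent ledger `θ - 1 = κ + π` for an arbitrary nonnegative sequence) is fed with

* the shifted class sequence `t := jterm` (a priori `jterm n ≤ exp (K √n)`, `Join.jterm_le_exp`);
* entropy `κ := 3/2`: `Join.joinEntropyAt_three_halves` (Hammond's Lemma 4.12 for tall classes),
  packaged with the truncated entropy mass `D i := if 6 ≤ i then Dent i else 0` and the injection
  `Dent i ≤ 64 x_c^{-16} · Umac i` (`Join.Dent_le_Umac`, scales `i ≥ 6`) by `Join.truncatedDent_macro_spec`;
* the rarity mass `U := Umac` of MACROSCOPIC global join plaquettes and the hypothesis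
  `JoinMacroRarity π`: `Umac i ≤ C (i+1)^b 2^{-π i} R'_{i+1} + C 2^{-4 i}`.

Its conclusion is `R'_i := blockMass jterm i ≤ C' 2^{s i}` for every `s > 1 - (3/2 + π) = -1/2 - π`
(the ledger's side condition `s ≥ -3/2` is automatic for `π ≤ 1`):

* `joinMass_blockDecay_of_joinMacroRarity` — `blockMass jterm i ≤ C 2^{s i}` for all `s > -1/2 - π`;
* `join_blockMass_term_le_of_joinMacroRarity` — through the block transfer
  `Join.blockMass_term_le_of_jterm` (one extra power `2^i` for re-rooting), the crux's ROOTED dyadic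
  blocks satisfy `blockMass term i ≤ C 2^{s i}` for all `s > 1/2 - π`, i.e. block-averaged
  `θ ≥ 3/2 + π`; at the proved floor `π = 0` (`Join.joinMacroRarity_zero`) this is Hammond's
  `θ ≥ 3/2` in averaged form, and `π > 1/2` would close the crux (`Join.criticalBubbleBound_of_joinMacroRarity`).

Everything here is sorry-free; the crux item is NOT closed by this file.

Source: A. Hammond, *An upper bound on the number of self-avoiding polygons via joining*,
Ann. Probab. 46 (2018) 175–206, §4 (Prop. 4.5, Lemma 4.12).
-/

noncomputable section

open Literature.Probability.LatticeModels
open Literature.Probability.RandomPlanarGeometry Literature.Probability.RandomPlanarGeometry.SAW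
open scoped BigOperators ENNReal
open Summit.CriticalPhenomena.SAWScalingLimit.Theorems.CriticalBubbleBound.Negative (e₀)
open Summit.CriticalPhenomena.SAWScalingLimit.Theorems.CriticalBubbleBound.Docking

namespace Summit.CriticalPhenomena.SAWScalingLimit.Theorems.CriticalBubbleBound.Join

/-- **Block decay of the shifted class sequence from macroscopic join rarity** (registered stub
`joinMass_blockDecay_of_joinMacroRarity`): for `0 ≤ π ≤ 1`, `JoinMacroRarity π` gives
`blockMass jterm i ≤ C 2^{s i}` for every `s > -1/2 - π` — the ledger `Docking.stub_ledgerBootstrap`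
at `κ = 3/2` (`joinEntropyAt_three_halves`, truncated below scale `6` and injected into `Umac` by
`truncatedDent_macro_spec`, `K₁ = 64 x_c^{-16}`) and rarity `U := Umac` with exponent `π`; the side
condition `-3/2 ≤ s` of the ledger follows from `π ≤ 1`. [cite: Hammond2015SAPJoining, §4] -/
theorem joinMass_blockDecay_of_joinMacroRarity : ∀ π : ℝ, 0 ≤ π → π ≤ 1 → JoinMacroRarity π → ∀ s : ℝ, -(1 : ℝ) / 2 - π < s → ∃ C : ℝ, ∀ i : ℕ, blockMass jterm i ≤ C * (2 : ℝ) ^ (s * (i : ℝ)) := by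
  intro π hπ0 hπ1 hrar s hs
  obtain ⟨c, hc, i₀, hent⟩ := joinEntropyAt_three_halves
  obtain ⟨hent', hinj⟩ := truncatedDent_macro_spec hent
  obtain ⟨C, b, hU⟩ := hrar
  have hK₁ : (0 : ℝ) < 64 * criticalFugacity⁻¹ ^ 16 :=
    mul_pos (by norm_num) (pow_pos (inv_pos.2 criticalFugacity_pos_lt_one'.1) 16)
  -- docking entropy in the ledger's shape (`blockMass jterm i` unfolded to the dyadic block sum)
  have hDock' : ∀ i : ℕ, max i₀ 6 ≤ i →
      c * (2 : ℝ) ^ (((3 / 2 : ℝ) - 1) * (i : ℝ)) *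
        (∑ n ∈ Finset.Ico (2 ^ i) (2 ^ (i + 1)), jterm n) ^ 2 ≤
          (fun i => if 6 ≤ i then Dent i else 0) i := by
    intro i hi
    rw [← blockMass_eq]
    exact hent' i hi
  -- macroscopic rarity in the ledger's shape
  have hU' : ∀ i : ℕ, Umac i ≤ C * ((i : ℝ) + 1) ^ b * (2 : ℝ) ^ (-π * (i : ℝ)) *
      (∑ n ∈ Finset.Ico (2 ^ (i + 1)) (2 ^ (i + 1 + 1)), jterm n)
        + C * (2 : ℝ) ^ (-(4 : ℝ) * (i : ℝ)) := by
    intro i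
    rw [← blockMass_eq]
    exact hU i
  -- the ledger at `(κ, π) = (3/2, π)`: `1 - (3/2 + π) = -1/2 - π < s` and `-3/2 ≤ s` (as `π ≤ 1`)
  obtain ⟨C', hC'⟩ := stub_ledgerBootstrap (3 / 2) π (by norm_num) jterm
    (fun i => if 6 ≤ i then Dent i else 0) Umac jterm_nonneg jterm_le_exp
    ⟨64 * criticalFugacity⁻¹ ^ 16, hK₁, hinj⟩ ⟨c, hc, max i₀ 6, hDock'⟩ ⟨C, b, hU'⟩ s
    (by linarith) (by linarith)
  exact ⟨C', fun i => by rw [blockMass_eq]; exact hC' i⟩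

/-- **Block-averaged `θ ≥ 3/2 + π` from macroscopic join rarity** (registered stub
`join_blockMass_term_le_of_joinMacroRarity`): for `0 ≤ π ≤ 1`, `JoinMacroRarity π` gives, for the
crux's ROOTED dyadic blocks `R_i = Σ_{n ∈ [2^i, 2^{i+1})} c_n(0,e₀) x_cⁿ`, the bound
`blockMass term i ≤ C 2^{s i}` for every `s > 1/2 - π`: `joinMass_blockDecay_of_joinMacroRarity` at
`s - 1 > -1/2 - π` and the block transfer `blockMass_term_le_of_jterm` (re-rooting costs one power
of `2^i`). [cite: Hammond2015SAPJoining, §4] -/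
theorem join_blockMass_term_le_of_joinMacroRarity : ∀ π : ℝ, 0 ≤ π → π ≤ 1 → JoinMacroRarity π → ∀ s : ℝ, (1 : ℝ) / 2 - π < s → ∃ C : ℝ, ∀ i : ℕ, blockMass term i ≤ C * (2 : ℝ) ^ (s * (i : ℝ)) := by
  intro π hπ0 hπ1 hrar s hs
  obtain ⟨C, hC⟩ := joinMass_blockDecay_of_joinMacroRarity π hπ0 hπ1 hrar (s - 1) (by linarith)
  obtain ⟨C', hC'⟩ := blockMass_term_le_of_jterm C (s - 1) hC
  refine ⟨C', fun i => ?_⟩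
  have := hC' i
  rwa [sub_add_cancel] at this

end Summit.CriticalPhenomena.SAWScalingLimit.Theorems.CriticalBubbleBound.Join

end
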